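import Summits.QuantumFields.YangMills.Theorems.InfiniteVolumeUniformBound
import Summits.QuantumFields.YangMills.Theorems.InfiniteVolumeShiftDefect
import Summits.QuantumFields.YangMills.Theorems.InfiniteVolumeSlackPointwise
import HarnessLib

/-!
# Infinite volume by compactness with UV SLACK: the a-uniform E0′ bound on every finite set and on `(ℤ⁴)ⁿ`

Support file for `SlackWindow.SlackCalibration` (stmt-QuantumFields-23098).  Verbatim twin of §§1–2 of the landed
`InfiniteVolumeUniformBound` (cell ym-fleet) with the collar currency `(C/R⁴)ⁿ` replaced by the SLACK currency
`(C/R⁴·((R·a)⁻¹)^σ)ⁿ` of route `SlackWindow` (`σ : ℕ`): a `ℤ⁴`-phrased slack collar weight meets the torus-phrased hypothesis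
of the slack toolkit X-b (`Slack.sum_abs_weight_mul_norm_le_slack`) on every box with `4R+8 ≤ L`, whence ONE absolute bound on
every finite `T ⊆ (ℤ⁴)ⁿ`, absolute summability, and the series bound `‖Σ'ₓ W(x)F(y x)‖ ≤ 7Kⁿ‖F‖_{(σ+10)n}` with
`K = (M·4⁴·5⁶ + M·2⁶·(10+2s)⁴ + 2^{σ+11}·C·(2/ℓ₄+48)^{σ+4})·2⁶·81Σ(m+1)⁻²`.

HONEST FRAMING: pure soft analysis ([folklore]); nothing about Bałaban's RG, reflection positivity, a mass gap or Clay; no summit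
is proved (rung R2a plumbing).  References: Glimm–Jaffe (1987) §6.1; Osterwalder–Schrader CMP 42 (1975) §2.
-/

set_option autoImplicit false

noncomputable section

open scoped BigOperators SchwartzMap LineDeriv
open MeasureTheory Filter Topology Set
open Literature.MathematicalPhysics.QuantumFieldTheory hiding ZdEdge
open Literature.MathematicalPhysics.QuantumLattice
open Literature.MathematicalPhysics.AQFT
open Literature.Probability.LatticeModels (box Site mem_box)
open Summit.QuantumFields.YangMills.Theorems.OSLegsFromFemtoAndGap
  (valMinAbs_intCast_of_abs_le norm_sub_le_lineDeriv seminorm_lineDeriv_le)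

namespace Summit.QuantumFields.YangMills.Theorems.InfiniteVolume.Slack

/-- The seven seminorms of the slack majorant are dominated by `7·‖F‖_{(σ+10)n}`. [folklore] -/
theorem seminorm_budget_le_schwartzNorm_slack {X : Type*} [NormedAddCommGroup X] [NormedSpace ℝ X] (σ n : ℕ)
    (F : 𝓢(X, ℂ)) :
    SchwartzMap.seminorm ℂ 0 (4 * n) F + SchwartzMap.seminorm ℂ (6 * n) (4 * n) F +
        SchwartzMap.seminorm ℂ 0 ((σ + 4) * n) F + SchwartzMap.seminorm ℂ (6 * n) ((σ + 4) * n) F +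
        SchwartzMap.seminorm ℂ 0 0 F + SchwartzMap.seminorm ℂ (6 * n) 0 F +
        SchwartzMap.seminorm ℂ (10 * n) 0 F ≤ 7 * schwartzNorm ((σ + 10) * n) F := by
  have e : (σ + 10) * n = σ * n + 10 * n := by ring
  have h4 : 4 * n ≤ (σ + 10) * n := by rw [e]; omega
  have h6 : 6 * n ≤ (σ + 10) * n := by rw [e]; omega
  have h10 : 10 * n ≤ (σ + 10) * n := by rw [e]; omega
  have hm : (σ + 4) * n ≤ (σ + 10) * n := Nat.mul_le_mul_right n (by omega)
  have h0 : 0 ≤ (σ + 10) * n := Nat.zero_le _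
  have h1 := seminorm_le_schwartzNorm (m := (σ + 10) * n) h0 h4 F
  have h2 := seminorm_le_schwartzNorm (m := (σ + 10) * n) h6 h4 F
  have h3 := seminorm_le_schwartzNorm (m := (σ + 10) * n) h0 hm F
  have h4' := seminorm_le_schwartzNorm (m := (σ + 10) * n) h6 hm F
  have h5 := seminorm_le_schwartzNorm (m := (σ + 10) * n) h0 h0 F
  have h6' := seminorm_le_schwartzNorm (m := (σ + 10) * n) h6 h0 F
  have h7 := seminorm_le_schwartzNorm (m := (σ + 10) * n) h10 h0 F
  linarith

/-- **A `ℤ⁴`-collar weight satisfies the torus-phrased collar hypothesis of toolkit X-b on every box.**  If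
`|W x| ≤ (C/R⁴)ⁿ` whenever the sites are pairwise `2R+4`-separated in some coordinate of `ℤ⁴` (`1 ≤ R`,
`R·a ≤ ℓ₄`), then for every `L` the same holds under torus separation mod `2L+1` with `4R+8 ≤ L`. [folklore] -/
theorem torusCollar_of_zdCollar_slack {n : ℕ} {W : (Fin n → Site 4) → ℝ} {C ℓ₄ a : ℝ} {σ : ℕ}
    (H : ∀ (x : Fin n → Site 4) (R : ℕ), 1 ≤ R → (R : ℝ) * a ≤ ℓ₄ →
      (∀ i j : Fin n, i ≠ j → ∃ k : Fin 4, (2 * (R : ℤ) + 4) ≤ |x i k - x j k|) →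
      |W x| ≤ (C / (R : ℝ) ^ 4 * (((R : ℝ) * a)⁻¹) ^ σ) ^ n)
    (L : ℕ) :
    ∀ (x : Fin n → Site 4) (R : ℕ), 1 ≤ R → (R : ℝ) * a ≤ ℓ₄ → 4 * R + 8 ≤ L →
      (∀ i j : Fin n, i ≠ j → ∃ k : Fin 4,
        (2 * (R : ℤ) + 4) ≤ |((((x i k - x j k : ℤ) : ZMod (2 * L + 1))).valMinAbs : ℤ)|) →
      |W x| ≤ (C / (R : ℝ) ^ 4 * (((R : ℝ) * a)⁻¹) ^ σ) ^ n := by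
  intro x R hR hRa hRL hsep
  refine H x R hR hRa fun i j hij => ?_
  obtain ⟨k, hk⟩ := hsep i j hij
  exact ⟨k, le_abs_of_le_abs_valMinAbs hRL hk⟩


variable {n : ℕ}

/-- **The a-uniform ABSOLUTE bound for `ℤ⁴`-collar weights on every finite set of multi-sites.**  `W` any weight
with sup bound `Mⁿ` and `ℤ⁴`-collar bound `(C/R⁴)ⁿ` (`1 ≤ R`, `R·a ≤ ℓ₄`); `0 < a ≤ 1`, `a ≤ ℓ₄`, `n ≥ 2`,
`0 ≤ s ≤ 6`, `s·a ≤ 1/4`; `F ∈ ⁰𝒮ₙ`; evaluation points `‖(y x)_l − a·x_l‖ ≤ s·a`.  Then for EVERY finite `T`: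
`Σ_{x ∈ T} |W x|·‖F (y x)‖ ≤ Kⁿ·(S₀,₄ₙ + S₆ₙ,₄ₙ + S₀,₀ + S₆ₙ,₀ + S₁₀ₙ,₀)(F)` with toolkit X-b's
`K = (M 4⁴5⁶ + M 2⁶(10+2s)⁴ + 16C 2⁶(2/ℓ₄+48)⁴)·2⁶·81 Σ (m+1)⁻²` (enclose `T` in a box of half-side
`≥ max 14 a⁻²` and apply `sum_abs_weight_mul_norm_le` through `torusCollar_of_zdCollar`). [folklore] -/
theorem sum_abs_weight_mul_norm_le_of_zdCollar_slack {C ℓ₄ M a s : ℝ} (hℓ : 0 < ℓ₄) (hC : 0 ≤ C) (hM : 0 ≤ M) (σ : ℕ)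
    (W : (Fin n → Site 4) → ℝ) (hWsup : ∀ x, |W x| ≤ M ^ n)
    (H : ∀ (x : Fin n → Site 4) (R : ℕ), 1 ≤ R → (R : ℝ) * a ≤ ℓ₄ →
      (∀ i j : Fin n, i ≠ j → ∃ k : Fin 4, (2 * (R : ℤ) + 4) ≤ |x i k - x j k|) →
      |W x| ≤ (C / (R : ℝ) ^ 4 * (((R : ℝ) * a)⁻¹) ^ σ) ^ n)
    (ha : 0 < a) (ha1 : a ≤ 1) (haℓ : a ≤ ℓ₄) (hn : 2 ≤ n) (hs : 0 ≤ s) (hs6 : s ≤ 6) (hsa : s * a ≤ 1 / 4)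
    (F : 𝓢((Fin n → EuclideanSpace ℝ (Fin 4)), ℂ)) (hF : IsOffDiagonal F)
    (y : (Fin n → Site 4) → (Fin n → EuclideanSpace ℝ (Fin 4)))
    (hyx : ∀ x l, ‖y x l - a • siteToE (x l)‖ ≤ s * a) (T : Finset (Fin n → Site 4)) :
    ∑ x ∈ T, |W x| * ‖F (y x)‖ ≤
      ((M * 4 ^ 4 * 5 ^ 6 + M * 2 ^ 6 * (10 + 2 * s) ^ 4 + 2 ^ (σ + 11) * C * (2 / ℓ₄ + 48) ^ (σ + 4)) * 2 ^ 6 *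
          (81 * ∑' m : ℕ, (((m : ℝ) + 1) ^ 2)⁻¹)) ^ n *
        (SchwartzMap.seminorm ℂ 0 (4 * n) F + SchwartzMap.seminorm ℂ (6 * n) (4 * n) F +
          SchwartzMap.seminorm ℂ 0 ((σ + 4) * n) F + SchwartzMap.seminorm ℂ (6 * n) ((σ + 4) * n) F +
          SchwartzMap.seminorm ℂ 0 0 F + SchwartzMap.seminorm ℂ (6 * n) 0 F +
          SchwartzMap.seminorm ℂ (10 * n) 0 F) := by
  classical
  -- a box of half-side `L ≥ max 14 ⌈a⁻²⌉` containing `T`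
  obtain ⟨L, hL, hTL⟩ := subset_piFinset_box T (max 14 ⌈a⁻¹ * a⁻¹⌉₊)
  have hL14 : 14 ≤ L := le_trans (le_max_left _ _) hL
  have hLa : a⁻¹ * a⁻¹ ≤ L := by
    have h1 : ((⌈a⁻¹ * a⁻¹⌉₊ : ℕ) : ℝ) ≤ L := by exact_mod_cast le_trans (le_max_right _ _) hL
    exact (Nat.le_ceil _).trans h1
  calc ∑ x ∈ T, |W x| * ‖F (y x)‖
      ≤ ∑ x ∈ Fintype.piFinset (fun _ : Fin n => box 4 L), |W x| * ‖F (y x)‖ :=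
        Finset.sum_le_sum_of_subset_of_nonneg hTL fun x _ _ => by positivity
    _ ≤ _ := sum_abs_weight_mul_norm_le_slack hℓ hC hM σ W hWsup (torusCollar_of_zdCollar_slack H L) ha ha1 haℓ hL14 hLa hn
        hs hs6 hsa F hF y hyx

/-- **Absolute summability on `(ℤ⁴)ⁿ`** of `x ↦ |W x|·‖F(y x)‖` under the hypotheses of
`sum_abs_weight_mul_norm_le_of_zdCollar`. [folklore] -/
theorem summable_abs_weight_mul_norm_slack {C ℓ₄ M a s : ℝ} (hℓ : 0 < ℓ₄) (hC : 0 ≤ C) (hM : 0 ≤ M) (σ : ℕ)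
    (W : (Fin n → Site 4) → ℝ) (hWsup : ∀ x, |W x| ≤ M ^ n)
    (H : ∀ (x : Fin n → Site 4) (R : ℕ), 1 ≤ R → (R : ℝ) * a ≤ ℓ₄ →
      (∀ i j : Fin n, i ≠ j → ∃ k : Fin 4, (2 * (R : ℤ) + 4) ≤ |x i k - x j k|) →
      |W x| ≤ (C / (R : ℝ) ^ 4 * (((R : ℝ) * a)⁻¹) ^ σ) ^ n)
    (ha : 0 < a) (ha1 : a ≤ 1) (haℓ : a ≤ ℓ₄) (hn : 2 ≤ n) (hs : 0 ≤ s) (hs6 : s ≤ 6) (hsa : s * a ≤ 1 / 4)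
    (F : 𝓢((Fin n → EuclideanSpace ℝ (Fin 4)), ℂ)) (hF : IsOffDiagonal F)
    (y : (Fin n → Site 4) → (Fin n → EuclideanSpace ℝ (Fin 4)))
    (hyx : ∀ x l, ‖y x l - a • siteToE (x l)‖ ≤ s * a) :
    Summable fun x : Fin n → Site 4 => |W x| * ‖F (y x)‖ :=
  summable_of_sum_le (fun x => by positivity)
    (sum_abs_weight_mul_norm_le_of_zdCollar_slack hℓ hC hM σ W hWsup H ha ha1 haℓ hn hs hs6 hsa F hF y hyx)

/-- **The series bound**: `Σ'_{x ∈ (ℤ⁴)ⁿ} |W x|·‖F(y x)‖ ≤ Kⁿ·Σ(F)`. [folklore] -/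
theorem tsum_abs_weight_mul_norm_le_slack {C ℓ₄ M a s : ℝ} (hℓ : 0 < ℓ₄) (hC : 0 ≤ C) (hM : 0 ≤ M) (σ : ℕ)
    (W : (Fin n → Site 4) → ℝ) (hWsup : ∀ x, |W x| ≤ M ^ n)
    (H : ∀ (x : Fin n → Site 4) (R : ℕ), 1 ≤ R → (R : ℝ) * a ≤ ℓ₄ →
      (∀ i j : Fin n, i ≠ j → ∃ k : Fin 4, (2 * (R : ℤ) + 4) ≤ |x i k - x j k|) →
      |W x| ≤ (C / (R : ℝ) ^ 4 * (((R : ℝ) * a)⁻¹) ^ σ) ^ n)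
    (ha : 0 < a) (ha1 : a ≤ 1) (haℓ : a ≤ ℓ₄) (hn : 2 ≤ n) (hs : 0 ≤ s) (hs6 : s ≤ 6) (hsa : s * a ≤ 1 / 4)
    (F : 𝓢((Fin n → EuclideanSpace ℝ (Fin 4)), ℂ)) (hF : IsOffDiagonal F)
    (y : (Fin n → Site 4) → (Fin n → EuclideanSpace ℝ (Fin 4)))
    (hyx : ∀ x l, ‖y x l - a • siteToE (x l)‖ ≤ s * a) :
    ∑' x : Fin n → Site 4, |W x| * ‖F (y x)‖ ≤
      ((M * 4 ^ 4 * 5 ^ 6 + M * 2 ^ 6 * (10 + 2 * s) ^ 4 + 2 ^ (σ + 11) * C * (2 / ℓ₄ + 48) ^ (σ + 4)) * 2 ^ 6 *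
          (81 * ∑' m : ℕ, (((m : ℝ) + 1) ^ 2)⁻¹)) ^ n *
        (SchwartzMap.seminorm ℂ 0 (4 * n) F + SchwartzMap.seminorm ℂ (6 * n) (4 * n) F +
          SchwartzMap.seminorm ℂ 0 ((σ + 4) * n) F + SchwartzMap.seminorm ℂ (6 * n) ((σ + 4) * n) F +
          SchwartzMap.seminorm ℂ 0 0 F + SchwartzMap.seminorm ℂ (6 * n) 0 F +
          SchwartzMap.seminorm ℂ (10 * n) 0 F) :=
  Real.tsum_le_of_sum_le (fun x => by positivity)
    (sum_abs_weight_mul_norm_le_of_zdCollar_slack hℓ hC hM σ W hWsup H ha ha1 haℓ hn hs hs6 hsa F hF y hyx)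

/-- **The complex series `Σ'ₓ W(x)·F(y x)` converges absolutely.** [folklore] -/
theorem summable_weight_mul_slack {C ℓ₄ M a s : ℝ} (hℓ : 0 < ℓ₄) (hC : 0 ≤ C) (hM : 0 ≤ M) (σ : ℕ)
    (W : (Fin n → Site 4) → ℝ) (hWsup : ∀ x, |W x| ≤ M ^ n)
    (H : ∀ (x : Fin n → Site 4) (R : ℕ), 1 ≤ R → (R : ℝ) * a ≤ ℓ₄ →
      (∀ i j : Fin n, i ≠ j → ∃ k : Fin 4, (2 * (R : ℤ) + 4) ≤ |x i k - x j k|) →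
      |W x| ≤ (C / (R : ℝ) ^ 4 * (((R : ℝ) * a)⁻¹) ^ σ) ^ n)
    (ha : 0 < a) (ha1 : a ≤ 1) (haℓ : a ≤ ℓ₄) (hn : 2 ≤ n) (hs : 0 ≤ s) (hs6 : s ≤ 6) (hsa : s * a ≤ 1 / 4)
    (F : 𝓢((Fin n → EuclideanSpace ℝ (Fin 4)), ℂ)) (hF : IsOffDiagonal F)
    (y : (Fin n → Site 4) → (Fin n → EuclideanSpace ℝ (Fin 4)))
    (hyx : ∀ x l, ‖y x l - a • siteToE (x l)‖ ≤ s * a) :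
    Summable fun x : Fin n → Site 4 => ((W x : ℝ) : ℂ) * F (y x) := by
  refine Summable.of_norm_bounded
    (summable_abs_weight_mul_norm_slack hℓ hC hM σ W hWsup H ha ha1 haℓ hn hs hs6 hsa F hF y hyx) fun x => ?_
  rw [norm_mul, Complex.norm_real, Real.norm_eq_abs]

/-- **The a-uniform bound for the series over `(ℤ⁴)ⁿ`**: `‖Σ'ₓ W(x)·F(y x)‖ ≤ Kⁿ·Σ(F) ≤ 7Kⁿ·‖F‖_{(σ+10)n}`
(`schwartzNorm`). [folklore] -/
theorem norm_tsum_weight_mul_le_slack {C ℓ₄ M a s : ℝ} (hℓ : 0 < ℓ₄) (hC : 0 ≤ C) (hM : 0 ≤ M) (σ : ℕ)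
    (W : (Fin n → Site 4) → ℝ) (hWsup : ∀ x, |W x| ≤ M ^ n)
    (H : ∀ (x : Fin n → Site 4) (R : ℕ), 1 ≤ R → (R : ℝ) * a ≤ ℓ₄ →
      (∀ i j : Fin n, i ≠ j → ∃ k : Fin 4, (2 * (R : ℤ) + 4) ≤ |x i k - x j k|) →
      |W x| ≤ (C / (R : ℝ) ^ 4 * (((R : ℝ) * a)⁻¹) ^ σ) ^ n)
    (ha : 0 < a) (ha1 : a ≤ 1) (haℓ : a ≤ ℓ₄) (hn : 2 ≤ n) (hs : 0 ≤ s) (hs6 : s ≤ 6) (hsa : s * a ≤ 1 / 4)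
    (F : 𝓢((Fin n → EuclideanSpace ℝ (Fin 4)), ℂ)) (hF : IsOffDiagonal F)
    (y : (Fin n → Site 4) → (Fin n → EuclideanSpace ℝ (Fin 4)))
    (hyx : ∀ x l, ‖y x l - a • siteToE (x l)‖ ≤ s * a) :
    ‖∑' x : Fin n → Site 4, ((W x : ℝ) : ℂ) * F (y x)‖ ≤
      7 * ((M * 4 ^ 4 * 5 ^ 6 + M * 2 ^ 6 * (10 + 2 * s) ^ 4 + 2 ^ (σ + 11) * C * (2 / ℓ₄ + 48) ^ (σ + 4)) * 2 ^ 6 *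
          (81 * ∑' m : ℕ, (((m : ℝ) + 1) ^ 2)⁻¹)) ^ n * schwartzNorm ((σ + 10) * n) F := by
  set K : ℝ := (M * 4 ^ 4 * 5 ^ 6 + M * 2 ^ 6 * (10 + 2 * s) ^ 4 + 2 ^ (σ + 11) * C * (2 / ℓ₄ + 48) ^ (σ + 4)) * 2 ^ 6 *
    (81 * ∑' m : ℕ, (((m : ℝ) + 1) ^ 2)⁻¹) with hK
  have hK0 : 0 ≤ K := by
    have : 0 ≤ ∑' m : ℕ, (((m : ℝ) + 1) ^ 2)⁻¹ := tsum_nonneg fun m => by positivity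
    positivity
  have hsum := summable_abs_weight_mul_norm_slack hℓ hC hM σ W hWsup H ha ha1 haℓ hn hs hs6 hsa F hF y hyx
  have hnorm : ∀ x : Fin n → Site 4, ‖((W x : ℝ) : ℂ) * F (y x)‖ = |W x| * ‖F (y x)‖ := fun x => by
    rw [norm_mul, Complex.norm_real, Real.norm_eq_abs]
  calc ‖∑' x : Fin n → Site 4, ((W x : ℝ) : ℂ) * F (y x)‖
      ≤ ∑' x : Fin n → Site 4, ‖((W x : ℝ) : ℂ) * F (y x)‖ := norm_tsum_le_tsum_norm (by simpa [hnorm] using hsum)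
    _ = ∑' x : Fin n → Site 4, |W x| * ‖F (y x)‖ := by simp_rw [hnorm]
    _ ≤ K ^ n * (SchwartzMap.seminorm ℂ 0 (4 * n) F + SchwartzMap.seminorm ℂ (6 * n) (4 * n) F +
          SchwartzMap.seminorm ℂ 0 ((σ + 4) * n) F + SchwartzMap.seminorm ℂ (6 * n) ((σ + 4) * n) F +
          SchwartzMap.seminorm ℂ 0 0 F + SchwartzMap.seminorm ℂ (6 * n) 0 F +
          SchwartzMap.seminorm ℂ (10 * n) 0 F) :=
        tsum_abs_weight_mul_norm_le_slack hℓ hC hM σ W hWsup H ha ha1 haℓ hn hs hs6 hsa F hF y hyx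
    _ ≤ K ^ n * (7 * schwartzNorm ((σ + 10) * n) F) := by
        gcongr
        exact seminorm_budget_le_schwartzNorm_slack σ n F
    _ = 7 * K ^ n * schwartzNorm ((σ + 10) * n) F := by ring

/-! ## The shift defect for slack `ℤ⁴`-collar weights (twin of `InfiniteVolumeShiftDefect` §1) -/

/-- The seven-term seminorm budget of the directional derivative. [folklore] -/
theorem budget_lineDeriv_le_slack (σ : ℕ) (F : 𝓢((Fin n → EuclideanSpace ℝ (Fin 4)), ℂ)) (e : Fin n → EuclideanSpace ℝ (Fin 4)) :
    SchwartzMap.seminorm ℂ 0 (4 * n) (∂_{e} F : 𝓢((Fin n → EuclideanSpace ℝ (Fin 4)), ℂ)) +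
        SchwartzMap.seminorm ℂ (6 * n) (4 * n) (∂_{e} F : 𝓢((Fin n → EuclideanSpace ℝ (Fin 4)), ℂ)) +
        SchwartzMap.seminorm ℂ 0 ((σ + 4) * n) (∂_{e} F : 𝓢((Fin n → EuclideanSpace ℝ (Fin 4)), ℂ)) +
        SchwartzMap.seminorm ℂ (6 * n) ((σ + 4) * n) (∂_{e} F : 𝓢((Fin n → EuclideanSpace ℝ (Fin 4)), ℂ)) +
        SchwartzMap.seminorm ℂ 0 0 (∂_{e} F : 𝓢((Fin n → EuclideanSpace ℝ (Fin 4)), ℂ)) +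
        SchwartzMap.seminorm ℂ (6 * n) 0 (∂_{e} F : 𝓢((Fin n → EuclideanSpace ℝ (Fin 4)), ℂ)) +
        SchwartzMap.seminorm ℂ (10 * n) 0 (∂_{e} F : 𝓢((Fin n → EuclideanSpace ℝ (Fin 4)), ℂ)) ≤
      ‖e‖ * (SchwartzMap.seminorm ℂ 0 (4 * n + 1) F + SchwartzMap.seminorm ℂ (6 * n) (4 * n + 1) F +
        SchwartzMap.seminorm ℂ 0 ((σ + 4) * n + 1) F + SchwartzMap.seminorm ℂ (6 * n) ((σ + 4) * n + 1) F +
        SchwartzMap.seminorm ℂ 0 1 F + SchwartzMap.seminorm ℂ (6 * n) 1 F + SchwartzMap.seminorm ℂ (10 * n) 1 F) := by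
  have h1 := seminorm_lineDeriv_le F e 0 (4 * n)
  have h2 := seminorm_lineDeriv_le F e (6 * n) (4 * n)
  have h3 := seminorm_lineDeriv_le F e 0 ((σ + 4) * n)
  have h4 := seminorm_lineDeriv_le F e (6 * n) ((σ + 4) * n)
  have h5 := seminorm_lineDeriv_le F e 0 0
  have h6 := seminorm_lineDeriv_le F e (6 * n) 0
  have h7 := seminorm_lineDeriv_le F e (10 * n) 0
  linarith

/-- **The shift defect is `O(‖c‖)`, infinite volume, absolute, every finite `T`.**  Abstract weights with sup bound
`Mⁿ` and `ℤ⁴`-collar bound; base points within `s₁a`, constant shift `‖c_l‖ ≤ s₂a`, `s₁+s₂ ≤ 6`, `(s₁+s₂)a ≤ 1/4`,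
`G ∈ ⁰𝒮ₙ`: `Σ_{x∈T} |W x|·‖G(y x + c) − G(y x)‖ ≤ 2‖c‖·Kⁿ·Σ⁺(G)`. [folklore] -/
theorem sum_abs_weight_shift_sub_le_of_zdCollar_slack {C ℓ₄ M a s₁ s₂ : ℝ} (hℓ : 0 < ℓ₄) (hC : 0 ≤ C) (hM : 0 ≤ M) (σ : ℕ)
    (W : (Fin n → Site 4) → ℝ) (hWsup : ∀ x, |W x| ≤ M ^ n)
    (H : ∀ (x : Fin n → Site 4) (R : ℕ), 1 ≤ R → (R : ℝ) * a ≤ ℓ₄ →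
      (∀ i j : Fin n, i ≠ j → ∃ k : Fin 4, (2 * (R : ℤ) + 4) ≤ |x i k - x j k|) →
      |W x| ≤ (C / (R : ℝ) ^ 4 * (((R : ℝ) * a)⁻¹) ^ σ) ^ n)
    (ha : 0 < a) (ha1 : a ≤ 1) (haℓ : a ≤ ℓ₄) (hn : 2 ≤ n)
    (hs₁ : 0 ≤ s₁) (hs₂ : 0 ≤ s₂) (hs6 : s₁ + s₂ ≤ 6) (hsa : (s₁ + s₂) * a ≤ 1 / 4)
    (G : 𝓢((Fin n → EuclideanSpace ℝ (Fin 4)), ℂ)) (hG : IsOffDiagonal G)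
    (y : (Fin n → Site 4) → (Fin n → EuclideanSpace ℝ (Fin 4)))
    (hyx : ∀ x l, ‖y x l - a • siteToE (x l)‖ ≤ s₁ * a)
    (c : Fin n → EuclideanSpace ℝ (Fin 4)) (hc : ∀ l, ‖c l‖ ≤ s₂ * a) (T : Finset (Fin n → Site 4)) :
    ∑ x ∈ T, |W x| * ‖G (y x + c) - G (y x)‖ ≤
      2 * ‖c‖ * ((M * 4 ^ 4 * 5 ^ 6 + M * 2 ^ 6 * (10 + 2 * (s₁ + s₂)) ^ 4 + 2 ^ (σ + 11) * C * (2 / ℓ₄ + 48) ^ (σ + 4)) *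
          2 ^ 6 * (81 * ∑' m : ℕ, (((m : ℝ) + 1) ^ 2)⁻¹)) ^ n *
        (SchwartzMap.seminorm ℂ 0 (4 * n + 1) G + SchwartzMap.seminorm ℂ (6 * n) (4 * n + 1) G +
          SchwartzMap.seminorm ℂ 0 ((σ + 4) * n + 1) G + SchwartzMap.seminorm ℂ (6 * n) ((σ + 4) * n + 1) G +
          SchwartzMap.seminorm ℂ 0 1 G + SchwartzMap.seminorm ℂ (6 * n) 1 G + SchwartzMap.seminorm ℂ (10 * n) 1 G) := by
  classical
  have hmv := fun x : Fin n → Site 4 => norm_sub_le_lineDeriv G (y x) c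
  choose τ₁ hτ₁ τ₂ hτ₂ hle using hmv
  have hshift : ∀ (τ : (Fin n → Site 4) → ℝ), (∀ x, τ x ∈ Ioo (0 : ℝ) 1) →
      ∀ x l, ‖(y x + τ x • c) l - a • siteToE (x l)‖ ≤ (s₁ + s₂) * a := by
    intro τ hτ x l
    have h1 : (y x + τ x • c) l - a • siteToE (x l) = (y x l - a • siteToE (x l)) + τ x • c l := by
      simp only [Pi.add_apply, Pi.smul_apply]; abel
    rw [h1]
    calc _ ≤ ‖y x l - a • siteToE (x l)‖ + ‖τ x • c l‖ := norm_add_le _ _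
      _ ≤ s₁ * a + s₂ * a := by
          refine add_le_add (hyx x l) ?_
          rw [norm_smul, Real.norm_of_nonneg (hτ x).1.le]
          calc τ x * ‖c l‖ ≤ 1 * ‖c l‖ := by gcongr; exact (hτ x).2.le
            _ ≤ s₂ * a := by rw [one_mul]; exact hc l
      _ = (s₁ + s₂) * a := by ring
  have hG' : IsOffDiagonal (∂_{c} G : 𝓢((Fin n → EuclideanSpace ℝ (Fin 4)), ℂ)) := hG.lineDeriv c
  have hs0 : 0 ≤ s₁ + s₂ := by positivity
  have hsum₁ := sum_abs_weight_mul_norm_le_of_zdCollar_slack hℓ hC hM σ W hWsup H ha ha1 haℓ hn hs0 hs6 hsa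
    (∂_{c} G : 𝓢((Fin n → EuclideanSpace ℝ (Fin 4)), ℂ)) hG' (fun x => y x + τ₁ x • c) (hshift τ₁ hτ₁) T
  have hsum₂ := sum_abs_weight_mul_norm_le_of_zdCollar_slack hℓ hC hM σ W hWsup H ha ha1 haℓ hn hs0 hs6 hsa
    (∂_{c} G : 𝓢((Fin n → EuclideanSpace ℝ (Fin 4)), ℂ)) hG' (fun x => y x + τ₂ x • c) (hshift τ₂ hτ₂) T
  set KK := ((M * 4 ^ 4 * 5 ^ 6 + M * 2 ^ 6 * (10 + 2 * (s₁ + s₂)) ^ 4 + 2 ^ (σ + 11) * C * (2 / ℓ₄ + 48) ^ (σ + 4)) *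
    2 ^ 6 * (81 * ∑' m : ℕ, (((m : ℝ) + 1) ^ 2)⁻¹)) ^ n with hKK
  have hKK0 : 0 ≤ KK := by
    have : 0 ≤ ∑' m : ℕ, (((m : ℝ) + 1) ^ 2)⁻¹ := tsum_nonneg fun m => by positivity
    positivity
  have hbud := budget_lineDeriv_le_slack σ G c
  calc ∑ x ∈ T, |W x| * ‖G (y x + c) - G (y x)‖
      ≤ ∑ x ∈ T, (|W x| * ‖(∂_{c} G : 𝓢((Fin n → EuclideanSpace ℝ (Fin 4)), ℂ)) (y x + τ₁ x • c)‖ +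
          |W x| * ‖(∂_{c} G : 𝓢((Fin n → EuclideanSpace ℝ (Fin 4)), ℂ)) (y x + τ₂ x • c)‖) := by
        refine Finset.sum_le_sum fun x _ => ?_
        rw [← mul_add]
        exact mul_le_mul_of_nonneg_left (hle x) (abs_nonneg _)
    _ = (∑ x ∈ T, |W x| * ‖(∂_{c} G : 𝓢((Fin n → EuclideanSpace ℝ (Fin 4)), ℂ)) (y x + τ₁ x • c)‖) +
        ∑ x ∈ T, |W x| * ‖(∂_{c} G : 𝓢((Fin n → EuclideanSpace ℝ (Fin 4)), ℂ)) (y x + τ₂ x • c)‖ :=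
        Finset.sum_add_distrib
    _ ≤ KK * (SchwartzMap.seminorm ℂ 0 (4 * n) (∂_{c} G : 𝓢((Fin n → EuclideanSpace ℝ (Fin 4)), ℂ)) +
          SchwartzMap.seminorm ℂ (6 * n) (4 * n) (∂_{c} G : 𝓢((Fin n → EuclideanSpace ℝ (Fin 4)), ℂ)) +
          SchwartzMap.seminorm ℂ 0 ((σ + 4) * n) (∂_{c} G : 𝓢((Fin n → EuclideanSpace ℝ (Fin 4)), ℂ)) +
          SchwartzMap.seminorm ℂ (6 * n) ((σ + 4) * n) (∂_{c} G : 𝓢((Fin n → EuclideanSpace ℝ (Fin 4)), ℂ)) +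
          SchwartzMap.seminorm ℂ 0 0 (∂_{c} G : 𝓢((Fin n → EuclideanSpace ℝ (Fin 4)), ℂ)) +
          SchwartzMap.seminorm ℂ (6 * n) 0 (∂_{c} G : 𝓢((Fin n → EuclideanSpace ℝ (Fin 4)), ℂ)) +
          SchwartzMap.seminorm ℂ (10 * n) 0 (∂_{c} G : 𝓢((Fin n → EuclideanSpace ℝ (Fin 4)), ℂ))) +
        KK * (SchwartzMap.seminorm ℂ 0 (4 * n) (∂_{c} G : 𝓢((Fin n → EuclideanSpace ℝ (Fin 4)), ℂ)) +
          SchwartzMap.seminorm ℂ (6 * n) (4 * n) (∂_{c} G : 𝓢((Fin n → EuclideanSpace ℝ (Fin 4)), ℂ)) +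
          SchwartzMap.seminorm ℂ 0 ((σ + 4) * n) (∂_{c} G : 𝓢((Fin n → EuclideanSpace ℝ (Fin 4)), ℂ)) +
          SchwartzMap.seminorm ℂ (6 * n) ((σ + 4) * n) (∂_{c} G : 𝓢((Fin n → EuclideanSpace ℝ (Fin 4)), ℂ)) +
          SchwartzMap.seminorm ℂ 0 0 (∂_{c} G : 𝓢((Fin n → EuclideanSpace ℝ (Fin 4)), ℂ)) +
          SchwartzMap.seminorm ℂ (6 * n) 0 (∂_{c} G : 𝓢((Fin n → EuclideanSpace ℝ (Fin 4)), ℂ)) +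
          SchwartzMap.seminorm ℂ (10 * n) 0 (∂_{c} G : 𝓢((Fin n → EuclideanSpace ℝ (Fin 4)), ℂ))) := add_le_add hsum₁ hsum₂
    _ ≤ KK * (‖c‖ * (SchwartzMap.seminorm ℂ 0 (4 * n + 1) G + SchwartzMap.seminorm ℂ (6 * n) (4 * n + 1) G +
          SchwartzMap.seminorm ℂ 0 ((σ + 4) * n + 1) G + SchwartzMap.seminorm ℂ (6 * n) ((σ + 4) * n + 1) G +
          SchwartzMap.seminorm ℂ 0 1 G + SchwartzMap.seminorm ℂ (6 * n) 1 G + SchwartzMap.seminorm ℂ (10 * n) 1 G)) +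
        KK * (‖c‖ * (SchwartzMap.seminorm ℂ 0 (4 * n + 1) G + SchwartzMap.seminorm ℂ (6 * n) (4 * n + 1) G +
          SchwartzMap.seminorm ℂ 0 ((σ + 4) * n + 1) G + SchwartzMap.seminorm ℂ (6 * n) ((σ + 4) * n + 1) G +
          SchwartzMap.seminorm ℂ 0 1 G + SchwartzMap.seminorm ℂ (6 * n) 1 G + SchwartzMap.seminorm ℂ (10 * n) 1 G)) := by
        gcongr
    _ = _ := by ring

/-- `Σ⁺(G) ≤ 7·‖G‖_{(σ+10)n+1}`. [folklore] -/
theorem budget_succ_le_schwartzNorm_slack (σ : ℕ) (G : 𝓢((Fin n → EuclideanSpace ℝ (Fin 4)), ℂ)) :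
    SchwartzMap.seminorm ℂ 0 (4 * n + 1) G + SchwartzMap.seminorm ℂ (6 * n) (4 * n + 1) G +
        SchwartzMap.seminorm ℂ 0 ((σ + 4) * n + 1) G + SchwartzMap.seminorm ℂ (6 * n) ((σ + 4) * n + 1) G +
        SchwartzMap.seminorm ℂ 0 1 G + SchwartzMap.seminorm ℂ (6 * n) 1 G + SchwartzMap.seminorm ℂ (10 * n) 1 G ≤
      7 * schwartzNorm ((σ + 10) * n + 1) G := by
  have e : (σ + 10) * n = σ * n + 10 * n := by ring
  have h4 : 4 * n + 1 ≤ (σ + 10) * n + 1 := by rw [e]; omega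
  have h6 : 6 * n ≤ (σ + 10) * n + 1 := by rw [e]; omega
  have h10 : 10 * n ≤ (σ + 10) * n + 1 := by rw [e]; omega
  have hm : (σ + 4) * n + 1 ≤ (σ + 10) * n + 1 := Nat.add_le_add_right (Nat.mul_le_mul_right n (by omega)) 1
  have h0 : 0 ≤ (σ + 10) * n + 1 := Nat.zero_le _
  have h1' : 1 ≤ (σ + 10) * n + 1 := by omega
  have h1 := seminorm_le_schwartzNorm (m := (σ + 10) * n + 1) h0 h4 G
  have h2 := seminorm_le_schwartzNorm (m := (σ + 10) * n + 1) h6 h4 G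
  have h3 := seminorm_le_schwartzNorm (m := (σ + 10) * n + 1) h0 hm G
  have h4' := seminorm_le_schwartzNorm (m := (σ + 10) * n + 1) h6 hm G
  have h5 := seminorm_le_schwartzNorm (m := (σ + 10) * n + 1) h0 h1' G
  have h6' := seminorm_le_schwartzNorm (m := (σ + 10) * n + 1) h6 h1' G
  have h7 := seminorm_le_schwartzNorm (m := (σ + 10) * n + 1) h10 h1' G
  linarith

/-- **Series form of the shift defect**: `‖Σ'ₓ W(x)·G(y x + c) − Σ'ₓ W(x)·G(y x)‖ ≤ 2‖c‖·Kⁿ·5‖G‖_{10n+1}`. [folklore] -/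
theorem norm_tsum_weight_shift_sub_le_of_zdCollar_slack {C ℓ₄ M a s₁ s₂ : ℝ} (hℓ : 0 < ℓ₄) (hC : 0 ≤ C) (hM : 0 ≤ M) (σ : ℕ)
    (W : (Fin n → Site 4) → ℝ) (hWsup : ∀ x, |W x| ≤ M ^ n)
    (H : ∀ (x : Fin n → Site 4) (R : ℕ), 1 ≤ R → (R : ℝ) * a ≤ ℓ₄ →
      (∀ i j : Fin n, i ≠ j → ∃ k : Fin 4, (2 * (R : ℤ) + 4) ≤ |x i k - x j k|) →
      |W x| ≤ (C / (R : ℝ) ^ 4 * (((R : ℝ) * a)⁻¹) ^ σ) ^ n)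
    (ha : 0 < a) (ha1 : a ≤ 1) (haℓ : a ≤ ℓ₄) (hn : 2 ≤ n)
    (hs₁ : 0 ≤ s₁) (hs₂ : 0 ≤ s₂) (hs6 : s₁ + s₂ ≤ 6) (hsa : (s₁ + s₂) * a ≤ 1 / 4)
    (G : 𝓢((Fin n → EuclideanSpace ℝ (Fin 4)), ℂ)) (hG : IsOffDiagonal G)
    (y : (Fin n → Site 4) → (Fin n → EuclideanSpace ℝ (Fin 4)))
    (hyx : ∀ x l, ‖y x l - a • siteToE (x l)‖ ≤ s₁ * a)
    (c : Fin n → EuclideanSpace ℝ (Fin 4)) (hc : ∀ l, ‖c l‖ ≤ s₂ * a) :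
    ‖∑' x : Fin n → Site 4, ((W x : ℝ) : ℂ) * G (y x + c) - ∑' x : Fin n → Site 4, ((W x : ℝ) : ℂ) * G (y x)‖ ≤
      2 * ‖c‖ * ((M * 4 ^ 4 * 5 ^ 6 + M * 2 ^ 6 * (10 + 2 * (s₁ + s₂)) ^ 4 + 2 ^ (σ + 11) * C * (2 / ℓ₄ + 48) ^ (σ + 4)) *
          2 ^ 6 * (81 * ∑' m : ℕ, (((m : ℝ) + 1) ^ 2)⁻¹)) ^ n * (7 * schwartzNorm ((σ + 10) * n + 1) G) := by
  set KK := ((M * 4 ^ 4 * 5 ^ 6 + M * 2 ^ 6 * (10 + 2 * (s₁ + s₂)) ^ 4 + 2 ^ (σ + 11) * C * (2 / ℓ₄ + 48) ^ (σ + 4)) *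
    2 ^ 6 * (81 * ∑' m : ℕ, (((m : ℝ) + 1) ^ 2)⁻¹)) ^ n with hKK
  have hKK0 : 0 ≤ KK := by
    have : 0 ≤ ∑' m : ℕ, (((m : ℝ) + 1) ^ 2)⁻¹ := tsum_nonneg fun m => by positivity
    positivity
  -- both shifted and unshifted evaluation maps are within `6a`
  have hsa₁ : s₁ * a ≤ 1 / 4 := le_trans (by nlinarith [ha.le]) hsa
  have hy' : ∀ x l, ‖(y x + c) l - a • siteToE (x l)‖ ≤ (s₁ + s₂) * a := fun x l => by
    have h1 : (y x + c) l - a • siteToE (x l) = (y x l - a • siteToE (x l)) + c l := by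
      simp only [Pi.add_apply]; abel
    rw [h1]
    calc _ ≤ ‖y x l - a • siteToE (x l)‖ + ‖c l‖ := norm_add_le _ _
      _ ≤ s₁ * a + s₂ * a := add_le_add (hyx x l) (hc l)
      _ = (s₁ + s₂) * a := by ring
  have hB : 0 ≤ M ^ n := pow_nonneg hM n
  have hsum1 := summable_mul_of_bounded ha ha1 hsa hB W hWsup G (fun x => y x + c) hy'
  have hsum2 := summable_mul_of_bounded ha ha1 hsa₁ hB W hWsup G y hyx
  rw [← Summable.tsum_sub hsum1 hsum2]
  have hnorm : ∀ x : Fin n → Site 4, ‖((W x : ℝ) : ℂ) * G (y x + c) - ((W x : ℝ) : ℂ) * G (y x)‖ =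
      |W x| * ‖G (y x + c) - G (y x)‖ := fun x => by
    rw [← mul_sub, norm_mul, Complex.norm_real, Real.norm_eq_abs]
  have hle := sum_abs_weight_shift_sub_le_of_zdCollar_slack hℓ hC hM σ W hWsup H ha ha1 haℓ hn hs₁ hs₂ hs6 hsa G hG y hyx
    c hc
  have hsumm : Summable fun x : Fin n → Site 4 => |W x| * ‖G (y x + c) - G (y x)‖ :=
    summable_of_sum_le (fun x => by positivity) hle
  calc ‖∑' x : Fin n → Site 4, (((W x : ℝ) : ℂ) * G (y x + c) - ((W x : ℝ) : ℂ) * G (y x))‖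
      ≤ ∑' x : Fin n → Site 4, ‖((W x : ℝ) : ℂ) * G (y x + c) - ((W x : ℝ) : ℂ) * G (y x)‖ :=
        norm_tsum_le_tsum_norm (by simpa [hnorm] using hsumm)
    _ = ∑' x : Fin n → Site 4, |W x| * ‖G (y x + c) - G (y x)‖ := by simp_rw [hnorm]
    _ ≤ 2 * ‖c‖ * KK * (SchwartzMap.seminorm ℂ 0 (4 * n + 1) G + SchwartzMap.seminorm ℂ (6 * n) (4 * n + 1) G +
          SchwartzMap.seminorm ℂ 0 ((σ + 4) * n + 1) G + SchwartzMap.seminorm ℂ (6 * n) ((σ + 4) * n + 1) G +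
          SchwartzMap.seminorm ℂ 0 1 G + SchwartzMap.seminorm ℂ (6 * n) 1 G + SchwartzMap.seminorm ℂ (10 * n) 1 G) :=
        Real.tsum_le_of_sum_le (fun x => by positivity) hle
    _ ≤ 2 * ‖c‖ * KK * (7 * schwartzNorm ((σ + 10) * n + 1) G) := by
        gcongr
        exact budget_succ_le_schwartzNorm_slack σ G

end Summit.QuantumFields.YangMills.Theorems.InfiniteVolume.Slack

end
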